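import Summits.BirchSwinnertonDyer.BirchSwinnertonDyer.Theorems.KolyvaginDepthDoorKolyvaginDepthSupplyDoor
import Summits.BirchSwinnertonDyer.BirchSwinnertonDyer.Theorems.SelmerRankSelmerRankLBStubHeegnerFieldSupply
import Summits.BirchSwinnertonDyer.BirchSwinnertonDyer.Theorems.SelmerRankSelmerRankLBStubTwistCorankEq
import HarnessLib

/-!
# Route `KolyvaginDepthDoor`, crux `KolyvaginDepthSupply` (stmt-BirchSwinnertonDyer-21765) —
# the rank-2 slice is EXACTLY X1 at a big-image prime, modulo theorems in print

Helper file (`--supports stmt-BirchSwinnertonDyer-21765 --as helper`); it closes nothing and BSD is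
not proved by it. Companion of `KolyvaginDepthDoorKolyvaginDepthSupplyDoor` (the DOOR direction:
one non-zero Kolyvagin–Heegner class below the rank ⇒ `corank Ш(E)[p^∞] = 0`). This file proves
the SUPPLY direction and closes the circle at rank 2:

* `exists_kolyvaginClass_ne_zero_depth_eq_rank_sub_one` — modulo BCGS 2026 Thm. 1 (`hA` =
  `BurungaleEtAl2026_exists_kolyvaginClass_ne_zero`, Kolyvagin's conjecture `κ^∞ ≠ 0`, in print for
  `p > 3` good ordinary with `E[p]` irreducible) and Kolyvagin 1991 Thm. 4 (`hF`): for `E/ℚ`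
  globally minimal of rank `r ≥ 1`, `p ≥ 5` good ordinary with `ρ̄_{E,p}` onto, `K` an admissible
  Heegner field (`d_K` odd, `∉ {−3, −4}`, `p ∤ d_K`, `p` split in `K`) with
  `corank Sel_{p^∞}(E^{(d_K)}/ℚ) ≤ r − 1`, the vanishing `corank Ш(E)[p^∞] = 0` FORCES a non-zero
  class `c_M(n) ≠ 0` of depth exactly `ν(n) = r − 1`, minimal among the non-zero classes. (BCGS
  gives some non-zero class; at the minimiser Kolyvagin's dichotomy reads `max(c, c') = ν₀ + 1`
  with `c = r`, `c' ≤ r − 1`, so `ν₀ = r − 1`.)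
* `exists_kolyvaginClass_prime_ne_zero_of_rank_two_of_shaCorank_eq_zero` — rank 2: the class sits
  on ONE Kolyvagin prime `ℓ` (`n` square-free with one prime factor is prime).
* `kolyvaginClass_prime_ne_zero_iff_shaCorank_eq_zero_of_rank_two` — **the rank-2 slice per
  `(E, p, K)`:** modulo `{hA, hF}`, for rank-2 `E`, admissible `(p, K)` with `c'_p ≤ 1`:
  `(∃ ℓ, M, datum: c_M(ℓ) ≠ 0) ↔ corank Ш(E)[p^∞] = 0`. The depth table's question IS X1 at `p`.
* `depthRowSupplyRankTwo_iff_shaCorankZeroSurjRankTwo` — **class-wide calibration of the rank-2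
  slice:** modulo `{hA, hF}`, modularity `exists_isNewformOf`, the twist supplies
  `HoffsteinLuo1997_exists_twist_L_one_ne_zero` / `bumpFriedbergHoffstein_exists_heegnerField_split_twist_simpleZero`
  and Gross–Zagier–Kolyvagin `rank_eq_analyticRank_of_analyticRank_le_one` (all named facts of the
  tree, consumed through the landed stubs HK `stub_heegner_field_supply_of_facts` and HT
  `stub_twist_corank_eq_of_facts` of crux `SelmerRankLB`), the statement "every non-CM rank-2
  `E/ℚ` has an admissible `(p, K, ℓ, M)` with `c_M(ℓ) ≠ 0`" (the rank-2 slice of the crux in its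
  weak = depth-table form) is EQUIVALENT to "every non-CM rank-2 `E/ℚ` has a good ordinary `p ≥ 5`
  with `ρ̄_{E,p}` onto and `corank Ш(E)[p^∞] = 0`" (X1 at a big-image prime, rank 2). So the line's
  crux at rank 2 is neither weaker nor stronger than X1-at-a-surjective-prime: the door is a
  per-curve INSTRUMENT (critic's price), not distance to the summit.
* `weakDepthSupplyHighRank_iff_shaCorankZeroSurjHighRank` (appended) — the same calibration on
  the whole intended sector `rank E(ℚ) ≥ 2` (a class at depth exactly `rank − 1` ↔ `t_p = 0` at a
  big-image prime), modulo the same six facts.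

(The primes themselves are not in short supply: `exists_goodOrdinary_surjective_of_not_hasCM`, an
unconditional tree theorem — Serre's open image + infinitely many good ordinary primes — gives every
non-CM curve a good ordinary `p ≥ 5` of surjective mod-`p` image; what is open is `t_p = 0` there.)

References: [BurungaleEtAl2026] Burungale–Castella–Grossi–Skinner, Camb. J. Math. 14 (2026) =
arXiv:2312.09301, Thm. 1; [Kolyvagin1991MathAnn] Math. Ann. 291 (1991), §2 Thm. 4; [WZhang2014]
Camb. J. Math. 2 (2014), Thm. 1.2, Thm. 11.2 (i); [GreenbergLNM1716] §1; [JetchevLauterStein2009]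
arXiv:0707.0032, §3.6.
-/

set_option linter.dupNamespace false

noncomputable section

open scoped Classical

namespace Summit.BirchSwinnertonDyer.BirchSwinnertonDyer.Theorems.KolyvaginDepthDoor

open Literature.NumberTheory.EllipticCurves Literature.NumberTheory.EllipticCurves.ModularForms
  WeierstrassCurve
open Summit.BirchSwinnertonDyer.BirchSwinnertonDyer.Theorems

/-! ## Supply: `t_p = 0` forces a non-zero class at depth `rank − 1` -/

/-- **Supply direction (modulo BCGS 2026 Thm. 1 and Kolyvagin 1991 Thm. 4).** `E/ℚ` globally
minimal of rank `r` (necessarily `≥ 1`); `p ≥ 5` good ordinary with `ρ̄_{E,p}` onto; `K` imaginary quadratic with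
the Heegner hypothesis for `N_E`, `d_K` odd, `d_K ∉ {−3, −4}`, `p ∤ d_K`, `p` split in `K`;
`corank Sel_{p^∞}(E^{(d_K)}/ℚ) ≤ r − 1`. If `corank_{ℤ_p} Ш(E/ℚ)[p^∞] = 0` then some
Kolyvagin–Heegner class `c_M(n) ≠ 0` has depth exactly `ν(n) = r − 1` and is depth-minimal among
the non-zero classes of its system. Proof: (irr), (tor) `E(K)[p] = 0` and `p ∤ N_E` follow from
surjectivity / good reduction; `hA` yields a non-zero class; at the minimiser (`ν₀`) `hF` gives
`max(c, c') = ν₀ + 1`; Kummer with `t_p = 0` gives `c = r > r − 1 ≥ c'`, so `ν₀ + 1 = r`.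
CONDITIONAL on `hA`, `hF`. [cite: BurungaleEtAl2026, Thm. 1 (arXiv:2312.09301 §0.1)]
[cite: Kolyvagin1991MathAnn, §2 Thm. 4] [cite: GreenbergLNM1716, §1 pp. 54–57] -/
theorem exists_kolyvaginClass_ne_zero_depth_eq_rank_sub_one
    (hA : BurungaleEtAl2026_exists_kolyvaginClass_ne_zero)
    (hF : Kolyvagin1991_selmerCorank_of_kolyvaginClass_ne_zero)
    (W : WeierstrassCurve ℚ) [W.IsElliptic] [W.IsGloballyMinimal]
    (p : ℕ) [hp : Fact p.Prime] (h5 : 5 ≤ p) (hgood : W.HasGoodReductionAtPrime p)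
    (hord : ¬ (p : ℤ) ∣ W.frobeniusTrace p) (hsurj : W.HasSurjectiveModNGaloisRep p)
    (K : Type) [Field K] [NumberField K] (hK : IsImaginaryQuadratic K)
    (h3 : NumberField.discr K ≠ -3) (h4 : NumberField.discr K ≠ -4)
    (hpd : ¬ ((p : ℤ) ∣ NumberField.discr K)) [NeZero (W.conductorNorm ℤ)]
    (hH : SatisfiesHeegnerHypothesis (W.conductorNorm ℤ) K) (hodd : Odd (NumberField.discr K))
    (hps : SatisfiesHeegnerHypothesis p K)
    (hc' : (W.quadraticTwist (NumberField.discr K : ℚ)).selmerCorank p + 1 ≤ W.mordellWeilRank)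
    (ht : W.shaCorank p = 0) :
    ∃ (Dt : ModularParametrizationData W (W.conductorNorm ℤ)) (β : ℤ) (ι : K →+* ℂ) (n : ℕ)
      (d : KolyvaginHeegnerData Dt β ι n) (M : ℕ),
      KolyvaginDescent.KolSupp (Zhang2014.IsKolyvaginPrime (W.conductorNorm ℤ) W K p) n ∧
      1 ≤ M ∧ (M : ℕ∞) ≤ Zhang2014.levelIndex W p n ∧ d.kolyvaginClass hp.out M ≠ 0 ∧
      n.primeFactors.card + 1 = W.mordellWeilRank ∧
      (∀ (n' : ℕ) (d' : KolyvaginHeegnerData Dt β ι n') (M' : ℕ),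
        KolyvaginDescent.KolSupp (Zhang2014.IsKolyvaginPrime (W.conductorNorm ℤ) W K p) n' →
        1 ≤ M' → (M' : ℕ∞) ≤ Zhang2014.levelIndex W p n' → d'.kolyvaginClass hp.out M' ≠ 0 →
        n.primeFactors.card ≤ n'.primeFactors.card) := by
  have hpP : p.Prime := hp.out
  haveI : NeZero (p : ℚ) := ⟨by exact_mod_cast hpP.ne_zero⟩
  -- (irr), (tor) from surjectivity; `p ∤ N_E` from good reduction
  have hirr : W.HasIrreducibleModPGaloisRep p :=
    hasIrreducibleModPGaloisRep_of_hasSurjectiveModNGaloisRep W p hsurj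
  have htor : AddSubgroup.torsionBy (W.baseChange K).toAffine.Point (p : ℤ) = ⊥ :=
    torsionBy_eq_bot_of_isImaginaryQuadratic W K hK hpP (by omega) hsurj
  have hpN : ¬ (p ∣ W.conductorNorm ℤ) := fun h ↦
    (W.dvd_conductorNorm_iff_not_hasGoodReductionAtPrime p).mp h hgood
  -- BCGS Thm. 1: some class of the system attached to `(Dt, β, ι)` is non-zero
  obtain ⟨Dt, β, ι, n₁, d₁, M₁, hΛ₁, hM₁, hM₁le, hne₁⟩ :=
    hA W p (by omega) hgood hord hirr K hK hH hodd h3 htor hps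
  -- the minimiser and Kolyvagin's dichotomy there
  obtain ⟨n₀, d₀, M₀, hΛ₀, hM₀, hM₀le, hne₀, -, hmin, hstruct⟩ :=
    exists_minimal_kolyvaginClass_ne_zero hF W p h5 hsurj K hK h3 h4 hpd hpN hH Dt β ι n₁ d₁ M₁
      hΛ₁ hM₁ hM₁le hne₁
  have hid : W.selmerCorank p = W.mordellWeilRank + W.shaCorank p :=
    W.selmerCorank_eq_mordellWeilRank_add_holds p
  refine ⟨Dt, β, ι, n₀, d₀, M₀, hΛ₀, hM₀, hM₀le, hne₀, ?_, hmin⟩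
  rcases hstruct with ⟨hc, -, -⟩ | ⟨hc'', hc, -⟩
  · omega
  · exfalso
    omega

/-- A square-free natural number with exactly one prime factor is prime. [folklore] -/
theorem prime_of_squarefree_of_card_primeFactors_eq_one {n : ℕ} (hsq : Squarefree n)
    (h1 : n.primeFactors.card = 1) : n.Prime := by
  obtain ⟨ℓ, hℓ⟩ := Finset.card_eq_one.mp h1
  have hℓmem : ℓ ∈ n.primeFactors := by rw [hℓ]; exact Finset.mem_singleton_self ℓ
  have hℓp : ℓ.Prime := Nat.prime_of_mem_primeFactors hℓmem
  have hprod : ∏ q ∈ n.primeFactors, q = n := Nat.prod_primeFactors_of_squarefree hsq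
  rw [hℓ, Finset.prod_singleton] at hprod
  rw [← hprod]
  exact hℓp

/-- **Rank 2: `t_p = 0` forces a non-zero FIRST derived class (modulo BCGS 2026 Thm. 1 and
Kolyvagin 1991 Thm. 4).** In the setting of `exists_kolyvaginClass_ne_zero_depth_eq_rank_sub_one`
with `rank E(ℚ) = 2` and `corank Sel_{p^∞}(E^{(d_K)}/ℚ) ≤ 1`: if `corank Ш(E)[p^∞] = 0` then
there are ONE Kolyvagin prime `ℓ`, a Kolyvagin–Heegner datum of conductor `ℓ` and a level
`1 ≤ M ≤ M(ℓ)` with `c_M(ℓ) ≠ 0` — a row the depth table must eventually find. CONDITIONAL on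
`hA`, `hF`. [cite: BurungaleEtAl2026, Thm. 1 (arXiv:2312.09301 §0.1)]
[cite: Kolyvagin1991MathAnn, §2 Thm. 4] -/
theorem exists_kolyvaginClass_prime_ne_zero_of_rank_two_of_shaCorank_eq_zero
    (hA : BurungaleEtAl2026_exists_kolyvaginClass_ne_zero)
    (hF : Kolyvagin1991_selmerCorank_of_kolyvaginClass_ne_zero)
    (W : WeierstrassCurve ℚ) [W.IsElliptic] [W.IsGloballyMinimal] (hr : W.mordellWeilRank = 2)
    (p : ℕ) [hp : Fact p.Prime] (h5 : 5 ≤ p) (hgood : W.HasGoodReductionAtPrime p)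
    (hord : ¬ (p : ℤ) ∣ W.frobeniusTrace p) (hsurj : W.HasSurjectiveModNGaloisRep p)
    (K : Type) [Field K] [NumberField K] (hK : IsImaginaryQuadratic K)
    (h3 : NumberField.discr K ≠ -3) (h4 : NumberField.discr K ≠ -4)
    (hpd : ¬ ((p : ℤ) ∣ NumberField.discr K)) [NeZero (W.conductorNorm ℤ)]
    (hH : SatisfiesHeegnerHypothesis (W.conductorNorm ℤ) K) (hodd : Odd (NumberField.discr K))
    (hps : SatisfiesHeegnerHypothesis p K)
    (hc' : (W.quadraticTwist (NumberField.discr K : ℚ)).selmerCorank p ≤ 1)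
    (ht : W.shaCorank p = 0) :
    ∃ (Dt : ModularParametrizationData W (W.conductorNorm ℤ)) (β : ℤ) (ι : K →+* ℂ) (ℓ : ℕ)
      (d : KolyvaginHeegnerData Dt β ι ℓ) (M : ℕ),
      ℓ.Prime ∧ Zhang2014.IsKolyvaginPrime (W.conductorNorm ℤ) W K p ℓ ∧
      1 ≤ M ∧ (M : ℕ∞) ≤ Zhang2014.levelIndex W p ℓ ∧ d.kolyvaginClass hp.out M ≠ 0 := by
  obtain ⟨Dt, β, ι, n, d, M, ⟨hsq, hkol⟩, hM, hMle, hne, hcard, -⟩ :=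
    exists_kolyvaginClass_ne_zero_depth_eq_rank_sub_one hA hF W p h5 hgood hord hsurj K hK h3 h4
      hpd hH hodd hps (by omega) ht
  have h1 : n.primeFactors.card = 1 := by omega
  have hn : n.Prime := prime_of_squarefree_of_card_primeFactors_eq_one hsq h1
  have hmem : n ∈ n.primeFactors := by
    rw [hn.primeFactors]; exact Finset.mem_singleton_self n
  exact ⟨Dt, β, ι, n, d, M, hn, hkol n hmem, hM, hMle, hne⟩

/-! ## The rank-2 slice per `(E, p, K)`: depth row `↔` `t_p = 0` -/

/-- **The rank-2 slice of the crux, per `(E, p, K)`, is X1 at `p` (modulo BCGS 2026 Thm. 1 and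
Kolyvagin 1991 Thm. 4).** `E/ℚ` globally minimal of rank `2`; `p ≥ 5` good ordinary with
`ρ̄_{E,p}` onto; `K` an admissible Heegner field (`d_K` odd, `∉ {−3, −4}`, `p ∤ d_K`, `p` split)
with `corank Sel_{p^∞}(E^{(d_K)}/ℚ) ≤ 1`. Then: some first derived Kolyvagin–Heegner class is
non-zero (`∃` parametrisation datum, orientation, embedding, ONE Kolyvagin prime `ℓ`, datum of
conductor `ℓ`, level `1 ≤ M ≤ M(ℓ)` with `c_M(ℓ) ≠ 0`) **iff** `corank_{ℤ_p} Ш(E/ℚ)[p^∞] = 0`.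
`→` is the door (`shaCorank_eq_zero_of_rank_two_of_kolyvaginClass_prime_ne_zero`, `hF` only);
`←` is the supply above. The depth table's question at `(E, p, K)` is exactly X1 at `p`.
CONDITIONAL on `hA`, `hF`; BSD is not proved by it.
[cite: BurungaleEtAl2026, Thm. 1 (arXiv:2312.09301 §0.1)] [cite: Kolyvagin1991MathAnn, §2 Thm. 4]
[cite: WZhang2014, Thm. 11.2 (i) (p. 248)] -/
theorem kolyvaginClass_prime_ne_zero_iff_shaCorank_eq_zero_of_rank_two
    (hA : BurungaleEtAl2026_exists_kolyvaginClass_ne_zero)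
    (hF : Kolyvagin1991_selmerCorank_of_kolyvaginClass_ne_zero)
    (W : WeierstrassCurve ℚ) [W.IsElliptic] [W.IsGloballyMinimal] (hr : W.mordellWeilRank = 2)
    (p : ℕ) [hp : Fact p.Prime] (h5 : 5 ≤ p) (hgood : W.HasGoodReductionAtPrime p)
    (hord : ¬ (p : ℤ) ∣ W.frobeniusTrace p) (hsurj : W.HasSurjectiveModNGaloisRep p)
    (K : Type) [Field K] [NumberField K] (hK : IsImaginaryQuadratic K)
    (h3 : NumberField.discr K ≠ -3) (h4 : NumberField.discr K ≠ -4)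
    (hpd : ¬ ((p : ℤ) ∣ NumberField.discr K)) [NeZero (W.conductorNorm ℤ)]
    (hH : SatisfiesHeegnerHypothesis (W.conductorNorm ℤ) K) (hodd : Odd (NumberField.discr K))
    (hps : SatisfiesHeegnerHypothesis p K)
    (hc' : (W.quadraticTwist (NumberField.discr K : ℚ)).selmerCorank p ≤ 1) :
    (∃ (Dt : ModularParametrizationData W (W.conductorNorm ℤ)) (β : ℤ) (ι : K →+* ℂ) (ℓ : ℕ)
      (d : KolyvaginHeegnerData Dt β ι ℓ) (M : ℕ),
      ℓ.Prime ∧ Zhang2014.IsKolyvaginPrime (W.conductorNorm ℤ) W K p ℓ ∧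
      1 ≤ M ∧ (M : ℕ∞) ≤ Zhang2014.levelIndex W p ℓ ∧ d.kolyvaginClass hp.out M ≠ 0) ↔
    W.shaCorank p = 0 := by
  have hpN : ¬ (p ∣ W.conductorNorm ℤ) := fun h ↦
    (W.dvd_conductorNorm_iff_not_hasGoodReductionAtPrime p).mp h hgood
  constructor
  · rintro ⟨Dt, β, ι, ℓ, d, M, hℓ, hkol, hM, hMle, hne⟩
    exact (shaCorank_eq_zero_of_rank_two_of_kolyvaginClass_prime_ne_zero hF W hr p h5 hsurj K hK h3
      h4 hpd hpN hH Dt β ι ℓ hℓ hkol d M hM hMle hne).1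
  · exact exists_kolyvaginClass_prime_ne_zero_of_rank_two_of_shaCorank_eq_zero hA hF W hr p h5
      hgood hord hsurj K hK h3 h4 hpd hH hodd hps hc'

/-! ## Class-wide calibration of the rank-2 slice -/

/-- **Class-wide: the rank-2 slice of the crux (weak = depth-table form) is EQUIVALENT to X1 at a
big-image prime on rank-2 non-CM curves, modulo theorems in print.** Hypotheses: BCGS 2026 Thm. 1
(`hA`), Kolyvagin 1991 Thm. 4 (`hF`), modularity `exists_isNewformOf` (`hmod`), the twist supplies
of Hoffstein–Luo 1997 (`hHL`) and Bump–Friedberg–Hoffstein 1990 (`hBFH`), and Gross–Zagier–Kolyvagin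
`rank_eq_analyticRank_of_analyticRank_le_one` (`hGZK`) — all named facts of the tree, used through
the landed stubs HK (`stub_heegner_field_supply_of_facts`: an admissible Heegner field with
`ord_{s=1} L(E^{(d_K)}, s) ≤ 1`) and HT (`stub_twist_corank_eq_of_facts`:
`corank Sel_{p^∞}(E^{(d_K)}) = ord L(E^{(d_K)})`) of crux `SelmerRankLB`. Conclusion:
(every non-CM globally minimal `E/ℚ` of rank 2 has `p ≥ 5` good ordinary with `ρ̄_{E,p}` onto, an
admissible `K`, and `(Dt, β, ι, ℓ, d, M)` with `ℓ` a Kolyvagin prime and `c_M(ℓ) ≠ 0`) `↔` (every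
non-CM globally minimal `E/ℚ` of rank 2 has `p ≥ 5` good ordinary with `ρ̄_{E,p}` onto and
`corank Ш(E)[p^∞] = 0`). `→`: the door. `←`: at the X1-prime take `K` from HK, `c' = ord ≤ 1` from
HT, and the supply theorem. Reading (critic's price made formal): the crux at rank 2 is X1 at a
surjective prime in disguise — a per-curve instrument, no distance to the summit. CONDITIONAL on the
six facts; BSD is not proved by it. [cite: BurungaleEtAl2026, Thm. 1 (arXiv:2312.09301 §0.1)]
[cite: Kolyvagin1991MathAnn, §2 Thm. 4] [cite: WZhang2014, Thm. 11.2 (i) (p. 248)] -/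
theorem depthRowSupplyRankTwo_iff_shaCorankZeroSurjRankTwo
    (hA : BurungaleEtAl2026_exists_kolyvaginClass_ne_zero)
    (hF : Kolyvagin1991_selmerCorank_of_kolyvaginClass_ne_zero)
    (hmod : exists_isNewformOf) (hHL : HoffsteinLuo1997_exists_twist_L_one_ne_zero)
    (hBFH : bumpFriedbergHoffstein_exists_heegnerField_split_twist_simpleZero)
    (hGZK : rank_eq_analyticRank_of_analyticRank_le_one) :
    (∀ (W : WeierstrassCurve ℚ) [W.IsElliptic] [W.IsGloballyMinimal], ¬ W.HasCM →
        W.mordellWeilRank = 2 →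
        ∃ (p : ℕ) (hp : Fact p.Prime), 5 ≤ p ∧ W.HasGoodReductionAtPrime p ∧
          ¬ (p : ℤ) ∣ W.frobeniusTrace p ∧ W.HasSurjectiveModNGaloisRep p ∧
          ∃ (K : Type) (_ : Field K) (_ : NumberField K), IsImaginaryQuadratic K ∧
            NumberField.discr K ≠ -3 ∧ NumberField.discr K ≠ -4 ∧
            ¬ ((p : ℤ) ∣ NumberField.discr K) ∧ ¬ (p ∣ W.conductorNorm ℤ) ∧
            ∃ (_ : NeZero (W.conductorNorm ℤ)),
              SatisfiesHeegnerHypothesis (W.conductorNorm ℤ) K ∧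
              ∃ (Dt : ModularParametrizationData W (W.conductorNorm ℤ)) (β : ℤ) (ι : K →+* ℂ)
                (ℓ : ℕ) (d : KolyvaginHeegnerData Dt β ι ℓ) (M : ℕ),
                ℓ.Prime ∧ Zhang2014.IsKolyvaginPrime (W.conductorNorm ℤ) W K p ℓ ∧
                1 ≤ M ∧ (M : ℕ∞) ≤ Zhang2014.levelIndex W p ℓ ∧ d.kolyvaginClass hp.out M ≠ 0) ↔
    (∀ (W : WeierstrassCurve ℚ) [W.IsElliptic] [W.IsGloballyMinimal], ¬ W.HasCM →
        W.mordellWeilRank = 2 →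
        ∃ (p : ℕ) (_ : Fact p.Prime), 5 ≤ p ∧ W.HasGoodReductionAtPrime p ∧
          ¬ (p : ℤ) ∣ W.frobeniusTrace p ∧ W.HasSurjectiveModNGaloisRep p ∧ W.shaCorank p = 0) := by
  constructor
  · intro h W _ _ hcm hr
    obtain ⟨p, hp, h5, hgood, hord, hsurj, K, iF, iN, hK, h3, h4, hpd, hpN, iNZ, hH, Dt, β, ι, ℓ, d,
      M, hℓ, hkol, hM, hMle, hne⟩ := h W hcm hr
    exact ⟨p, hp, h5, hgood, hord, hsurj,
      (shaCorank_eq_zero_of_rank_two_of_kolyvaginClass_prime_ne_zero hF W hr p h5 hsurj K hK h3 h4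
        hpd hpN hH Dt β ι ℓ hℓ hkol d M hM hMle hne).1⟩
  · intro h W _ _ hcm hr
    obtain ⟨p, hp, h5, hgood, hord, hsurj, ht⟩ := h W hcm hr
    -- an admissible Heegner field at the X1-prime (HK), with `c' = ord L(E^{(d_K)}) ≤ 1` (HT)
    obtain ⟨K, iF, iN, hK, h3, h4, hpd, hH, hodd, hps, hle, -⟩ :=
      stub_heegner_field_supply_of_facts hmod hHL hBFH W p h5 hgood hord hsurj
    have hc' : (W.quadraticTwist (NumberField.discr K : ℚ)).selmerCorank p ≤ 1 := by
      rw [stub_twist_corank_eq_of_facts hGZK W p h5 hgood hord hsurj K hK h3 h4 hpd hH hle]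
      exact hle
    have hpN : ¬ (p ∣ W.conductorNorm ℤ) := fun h' ↦
      (W.dvd_conductorNorm_iff_not_hasGoodReductionAtPrime p).mp h' hgood
    haveI iNZ : NeZero (W.conductorNorm ℤ) := ⟨(W.conductorNorm_pos_holds).ne'⟩
    obtain ⟨Dt, β, ι, ℓ, d, M, hℓ, hkol, hM, hMle, hne⟩ :=
      exists_kolyvaginClass_prime_ne_zero_of_rank_two_of_shaCorank_eq_zero hA hF W hr p h5 hgood
        hord hsurj K hK h3 h4 hpd hH hodd hps hc' ht
    exact ⟨p, hp, h5, hgood, hord, hsurj, K, iF, iN, hK, h3, h4, hpd, hpN, iNZ, hH, Dt, β, ι, ℓ, d, M,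
      hℓ, hkol, hM, hMle, hne⟩

/-! ## Class-wide calibration on the whole intended sector `rank E(ℚ) ≥ 2` (appended) -/

/-- **Class-wide, all ranks `≥ 2`: the weak depth supply on non-CM curves of rank `≥ 2` is
EQUIVALENT to X1 at a big-image prime on those curves, modulo theorems in print.** Same six named
facts as `depthRowSupplyRankTwo_iff_shaCorankZeroSurjRankTwo` (BCGS 2026 Thm. 1 `hA`, Kolyvagin
1991 Thm. 4 `hF`, modularity `hmod`, Hoffstein–Luo `hHL`, Bump–Friedberg–Hoffstein `hBFH`,
Gross–Zagier–Kolyvagin `hGZK`). Left side: every non-CM globally minimal `E/ℚ` with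
`rank E(ℚ) ≥ 2` has `p ≥ 5` good ordinary with `ρ̄_{E,p}` onto, an admissible Heegner field `K`
(`d_K ∉ {−3, −4}`, `p ∤ d_K N_E`, Heegner hypothesis for `N_E`) and a non-zero Kolyvagin–Heegner
class `c_M(n) ≠ 0` (`n` a square-free product of Kolyvagin primes, `1 ≤ M ≤ M(n)`) of depth
`ν(n) + 1 = rank E(ℚ)` — the crux `KolyvaginDepthSupply` on its intended sector, in the weak
(depth-table) form of `kolyvaginDepthSupply_iff_weak`, first rank clause. Right side: every such
curve has `p ≥ 5` good ordinary with `ρ̄_{E,p}` onto and `corank_{ℤ_p} Ш(E)[p^∞] = 0`. `→`: the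
door (`hF` only). `←`: at the X1-prime, HK gives `K` with `ord L(E^{(d_K)}) ≤ 1`, HT turns it into
`c' ≤ 1 ≤ rank − 1`, and `exists_kolyvaginClass_ne_zero_depth_eq_rank_sub_one` supplies the class
at depth exactly `rank − 1`. Reading: on rank `≥ 2` the line's crux IS X1-at-a-surjective-prime
modulo print (critic's price: an instrument, not distance to the summit); what the six facts do
NOT give is either side. CONDITIONAL; BSD is not proved by it.
[cite: BurungaleEtAl2026, Thm. 1 (arXiv:2312.09301 §0.1)] [cite: Kolyvagin1991MathAnn, §2 Thm. 4]
[cite: WZhang2014, Thm. 11.2 (i) (p. 248)] [cite: GreenbergLNM1716, §1 pp. 54–57] -/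
theorem weakDepthSupplyHighRank_iff_shaCorankZeroSurjHighRank
    (hA : BurungaleEtAl2026_exists_kolyvaginClass_ne_zero)
    (hF : Kolyvagin1991_selmerCorank_of_kolyvaginClass_ne_zero)
    (hmod : exists_isNewformOf) (hHL : HoffsteinLuo1997_exists_twist_L_one_ne_zero)
    (hBFH : bumpFriedbergHoffstein_exists_heegnerField_split_twist_simpleZero)
    (hGZK : rank_eq_analyticRank_of_analyticRank_le_one) :
    (∀ (W : WeierstrassCurve ℚ) [W.IsElliptic] [W.IsGloballyMinimal], ¬ W.HasCM →
        2 ≤ W.mordellWeilRank →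
        ∃ (p : ℕ) (hp : Fact p.Prime), 5 ≤ p ∧ W.HasGoodReductionAtPrime p ∧
          ¬ (p : ℤ) ∣ W.frobeniusTrace p ∧ W.HasSurjectiveModNGaloisRep p ∧
          ∃ (K : Type) (_ : Field K) (_ : NumberField K), IsImaginaryQuadratic K ∧
            NumberField.discr K ≠ -3 ∧ NumberField.discr K ≠ -4 ∧
            ¬ ((p : ℤ) ∣ NumberField.discr K) ∧ ¬ (p ∣ W.conductorNorm ℤ) ∧
            ∃ (_ : NeZero (W.conductorNorm ℤ)),
              SatisfiesHeegnerHypothesis (W.conductorNorm ℤ) K ∧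
              ∃ (Dt : ModularParametrizationData W (W.conductorNorm ℤ)) (β : ℤ) (ι : K →+* ℂ)
                (n : ℕ) (d : KolyvaginHeegnerData Dt β ι n) (M : ℕ),
                KolyvaginDescent.KolSupp (Zhang2014.IsKolyvaginPrime (W.conductorNorm ℤ) W K p) n ∧
                1 ≤ M ∧ (M : ℕ∞) ≤ Zhang2014.levelIndex W p n ∧ d.kolyvaginClass hp.out M ≠ 0 ∧
                n.primeFactors.card + 1 = W.mordellWeilRank) ↔
    (∀ (W : WeierstrassCurve ℚ) [W.IsElliptic] [W.IsGloballyMinimal], ¬ W.HasCM →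
        2 ≤ W.mordellWeilRank →
        ∃ (p : ℕ) (_ : Fact p.Prime), 5 ≤ p ∧ W.HasGoodReductionAtPrime p ∧
          ¬ (p : ℤ) ∣ W.frobeniusTrace p ∧ W.HasSurjectiveModNGaloisRep p ∧ W.shaCorank p = 0) := by
  constructor
  · intro h W _ _ hcm hr
    obtain ⟨p, hp, h5, hgood, hord, hsurj, K, iF, iN, hK, h3, h4, hpd, hpN, iNZ, hH, Dt, β, ι, n, d,
      M, hΛ, hM, hMle, hne, hcard⟩ := h W hcm hr
    exact ⟨p, hp, h5, hgood, hord, hsurj,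
      (shaCorank_eq_zero_of_kolyvaginClass_ne_zero_of_depth_lt_rank hF W p h5 hsurj K hK h3 h4 hpd
        hpN hH Dt β ι n d M hΛ hM hMle hne hcard.le).1⟩
  · intro h W _ _ hcm hr
    obtain ⟨p, hp, h5, hgood, hord, hsurj, ht⟩ := h W hcm hr
    obtain ⟨K, iF, iN, hK, h3, h4, hpd, hH, hodd, hps, hle, -⟩ :=
      stub_heegner_field_supply_of_facts hmod hHL hBFH W p h5 hgood hord hsurj
    have hc' : (W.quadraticTwist (NumberField.discr K : ℚ)).selmerCorank p + 1 ≤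
        W.mordellWeilRank := by
      rw [stub_twist_corank_eq_of_facts hGZK W p h5 hgood hord hsurj K hK h3 h4 hpd hH hle]
      omega
    have hpN : ¬ (p ∣ W.conductorNorm ℤ) := fun h' ↦
      (W.dvd_conductorNorm_iff_not_hasGoodReductionAtPrime p).mp h' hgood
    haveI iNZ : NeZero (W.conductorNorm ℤ) := ⟨(W.conductorNorm_pos_holds).ne'⟩
    obtain ⟨Dt, β, ι, n, d, M, hΛ, hM, hMle, hne, hcard, -⟩ :=
      exists_kolyvaginClass_ne_zero_depth_eq_rank_sub_one hA hF W p h5 hgood hord hsurj K hK h3 h4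
        hpd hH hodd hps hc' ht
    exact ⟨p, hp, h5, hgood, hord, hsurj, K, iF, iN, hK, h3, h4, hpd, hpN, iNZ, hH, Dt, β, ι, n, d, M,
      hΛ, hM, hMle, hne, hcard⟩

end Summit.BirchSwinnertonDyer.BirchSwinnertonDyer.Theorems.KolyvaginDepthDoor

end
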